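import Mathlib
import Summits.FinalStateConjecture.FinalStateConjecture.Theorems.PhotonSphereChannelsUniformPhotonSphereChannelsRPeelRung
import Summits.FinalStateConjecture.FinalStateConjecture.Theorems.PhotonSphereChannelsUniformPhotonSphereChannelsRPeelLevel

/-!
# Peeling, file 7: the energy identity of one rung, and the chain `ψ = θ₀ ↦ θ₁ ↦ ⋯ ↦ θ_ℓ = φ`

Support file for `stub_peel` of the line `crum-peeling-recessive-tower` (crux
`UniformPhotonSphereChannelsR`, stmt-FinalStateConjecture-14074).

For a rung `θ ↦ θ̃` (`θ̃_t = θ_x − Wθ`, `θ̃_x = θ_t − Wθ̃`, `W' = U − W²`, `Ũ = 2W² − U`) the energy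
densities `e = θ_t² + θ_x² + Uθ²` and `ẽ = θ̃_t² + θ̃_x² + Ũθ̃²` satisfy the POINTWISE identity
`ẽ = e − ∂ₓ(W (θ² + θ̃²))` (`hasDerivAt_rung_boundary`, file 3).  Integrating on `[X, Y]` and
letting `Y → ∞` (the boundary term `W(Y)(θ² + θ̃²)(t, Y) → 0` because `|Y W(Y)| ≤ B` and
`f(Y)²/Y → 0` for `f' ∈ L²`, `peel_sqrtGrowth`; square integrability at time `t` is
`level_integrable`) gives, for `X ≥ X₁` where `W ≤ 0`,
`∫_{(X,∞)} ẽ(t, ·) = ∫_{(X,∞)} e(t, ·) + W(X)(θ² + θ̃²)(t, X) ≤ ∫_{(X,∞)} e(t, ·)`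
(`rung_energy_le`): the far energies never increase along the peeling.

`exists_chain` then iterates the rung construction (file 5), its `t = 0` square integrability
(file 6) and `rung_energy_le` `n ≤ ℓ` times along the recessive ladder: solutions
`θ_0 = ψ, …, θ_n` of the `U_k`-equations on the half-plane with square-integrable data at `t = 0`,
consecutive ones related at `t = 0` by `∂ₜθ_{k+1} = (∂ₓ − W_k)θ_k`, `∂ₓθ_{k+1} = ∂ₜθ_k − W_kθ_{k+1}`,
and `∫_{(X,∞)} e_k(t) ≤ ∫_{(X,∞)} e_0(t)` for all `t` and `X ≥ X₁`.
-/

noncomputable section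

-- the doubled `FinalStateConjecture` component is the tree's fixed summit/problem path
set_option linter.dupNamespace false

namespace Summit.FinalStateConjecture.FinalStateConjecture.Theorems.CrumPeelingRecessiveTower

open MeasureTheory Set Filter Topology intervalIntegral
open scoped ContDiff



/-- **The rung never increases far energies.**  See the module docstring. -/
theorem rung_energy_le {a X₁ B C : ℝ} {U Ut W : ℝ → ℝ} {θ θn : ℝ → ℝ → ℝ}
    (haX : a < X₁) (hX1 : 1 ≤ X₁) (hUc : ContinuousOn U (Ioi a)) (hUtc : ContinuousOn Ut (Ioi a))
    (hWd : ∀ x, a < x → HasDerivAt W (U x - W x ^ 2) x)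
    (hUt : ∀ x, a < x → Ut x = 2 * W x ^ 2 - U x)
    (hrec : ∀ x, X₁ ≤ x → x * W x ≤ -3 / 4) (hWB : ∀ x, X₁ ≤ x → |x * W x| ≤ B)
    (hUB : ∀ x, X₁ ≤ x → |x ^ 2 * U x| ≤ C)
    (hU0 : ∀ x, X₁ ≤ x → 0 ≤ U x) (hUt0 : ∀ x, X₁ ≤ x → 0 ≤ Ut x)
    (hθ : ContDiffOn ℝ 2 (Function.uncurry θ) {z : ℝ × ℝ | a < z.2})
    (hsol : ∀ t x, a < x →
      iteratedDeriv 2 (fun τ => θ τ x) t - iteratedDeriv 2 (θ t) x + U x * θ t x = 0)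
    (hθn : ContDiffOn ℝ 2 (Function.uncurry θn) {z : ℝ × ℝ | a < z.2})
    (hsoln : ∀ t x, a < x →
      iteratedDeriv 2 (fun τ => θn τ x) t - iteratedDeriv 2 (θn t) x + Ut x * θn t x = 0)
    (hRt : ∀ t x, a < x → deriv (fun τ => θn τ x) t = deriv (θ t) x - W x * θ t x)
    (hRx : ∀ t x, a < x → deriv (θn t) x = deriv (fun τ => θ τ x) t - W x * θn t x)
    (hI1 : ∀ X, a < X → IntegrableOn (fun x => deriv (fun τ => θ τ x) 0 ^ 2) (Ioi X))
    (hI2 : ∀ X, a < X → IntegrableOn (fun x => deriv (θ 0) x ^ 2) (Ioi X))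
    (hI3 : ∀ X, a < X → 1 ≤ X → IntegrableOn (fun x => (θ 0 x / x) ^ 2) (Ioi X))
    (hJ1 : ∀ X, a < X → IntegrableOn (fun x => deriv (fun τ => θn τ x) 0 ^ 2) (Ioi X))
    (hJ2 : ∀ X, a < X → IntegrableOn (fun x => deriv (θn 0) x ^ 2) (Ioi X))
    (hJ3 : ∀ X, a < X → 1 ≤ X → IntegrableOn (fun x => (θn 0 x / x) ^ 2) (Ioi X))
    (t : ℝ) {X : ℝ} (hX : X₁ ≤ X) :
    IntegrableOn (fun x =>
      deriv (fun τ => θ τ x) t ^ 2 + deriv (θ t) x ^ 2 + U x * θ t x ^ 2) (Ioi X) ∧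
    IntegrableOn (fun x =>
      deriv (fun τ => θn τ x) t ^ 2 + deriv (θn t) x ^ 2 + Ut x * θn t x ^ 2) (Ioi X) ∧
    ∫ x in Ioi X, (deriv (fun τ => θn τ x) t ^ 2 + deriv (θn t) x ^ 2 + Ut x * θn t x ^ 2)
      ≤ ∫ x in Ioi X, (deriv (fun τ => θ τ x) t ^ 2 + deriv (θ t) x ^ 2 + U x * θ t x ^ 2) := by
  have hX₁0 : 0 < X₁ := by linarith
  have haX' : a < X := haX.trans_le hX
  -- size of the partner potential
  have hUtB : ∀ x, X₁ ≤ x → |x ^ 2 * Ut x| ≤ 2 * B ^ 2 + C := by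
    intro x hx
    have e : x ^ 2 * Ut x = 2 * (x * W x) ^ 2 - x ^ 2 * U x := by rw [hUt x (haX.trans_le hx)]; ring
    rw [e]
    have h1 : |x * W x| ^ 2 ≤ B ^ 2 := pow_le_pow_left₀ (abs_nonneg _) (hWB x hx) 2
    rw [sq_abs] at h1
    calc |2 * (x * W x) ^ 2 - x ^ 2 * U x| ≤ |2 * (x * W x) ^ 2| + |x ^ 2 * U x| := abs_sub _ _
      _ ≤ 2 * B ^ 2 + C := by
          rw [abs_of_nonneg (by positivity)]
          linarith [hUB x hx]
  -- square integrability at time `t`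
  obtain ⟨-, hθx2, -, he⟩ := level_integrable haX hX1 hUc hU0 hUB hθ hsol hI1 hI2 hI3 t haX'
  obtain ⟨-, hθnx2, -, hen⟩ := level_integrable haX hX1 hUtc hUt0 hUtB hθn hsoln hJ1 hJ2 hJ3 t haX'
  refine ⟨he, hen, ?_⟩
  -- dictionaries
  obtain ⟨dt, dx, -, -, -, hct, hcx, -, -, -, -, -, h1, h2, -, -, -, -, -, -⟩ := halfPlane_partials hθ
  obtain ⟨dtn, dxn, -, -, -, hctn, hcxn, -, -, -, -, -, h1n, h2n, -, -, -, -, -, -⟩ :=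
    halfPlane_partials hθn
  have hθc : ContinuousOn (θ t) (Ioi a) := continuousOn_slice_snd hθ.continuousOn t
  have hθnc : ContinuousOn (θn t) (Ioi a) := continuousOn_slice_snd hθn.continuousOn t
  have hdtc : ContinuousOn (fun x => deriv (fun τ => θ τ x) t) (Ioi a) :=
    (continuousOn_slice_snd hct t).congr fun x hx => (h1 t x hx).deriv
  have hdxc : ContinuousOn (fun x => deriv (θ t) x) (Ioi a) :=
    (continuousOn_slice_snd hcx t).congr fun x hx => (h2 t x hx).deriv
  have hdtnc : ContinuousOn (fun x => deriv (fun τ => θn τ x) t) (Ioi a) :=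
    (continuousOn_slice_snd hctn t).congr fun x hx => (h1n t x hx).deriv
  have hdxnc : ContinuousOn (fun x => deriv (θn t) x) (Ioi a) :=
    (continuousOn_slice_snd hcxn t).congr fun x hx => (h2n t x hx).deriv
  -- the three functions of `x`
  set e : ℝ → ℝ := fun x => deriv (fun τ => θ τ x) t ^ 2 + deriv (θ t) x ^ 2 + U x * θ t x ^ 2
    with he_def
  set en : ℝ → ℝ := fun x =>
    deriv (fun τ => θn τ x) t ^ 2 + deriv (θn t) x ^ 2 + Ut x * θn t x ^ 2 with hen_def
  set b : ℝ → ℝ := fun x => W x * (θ t x ^ 2 + θn t x ^ 2) with hb_def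
  have hec : ContinuousOn e (Ioi a) := ((hdtc.pow 2).add (hdxc.pow 2)).add (hUc.mul (hθc.pow 2))
  have henc : ContinuousOn en (Ioi a) :=
    ((hdtnc.pow 2).add (hdxnc.pow 2)).add (hUtc.mul (hθnc.pow 2))
  have hbd : ∀ x, a < x → HasDerivAt b (e x - en x) x := by
    intro x hx
    exact hasDerivAt_rung_boundary (hWd x hx) rfl (hUt x hx)
      ((h2 t x hx).congr_deriv (h2 t x hx).deriv.symm) ((h2n t x hx).congr_deriv (h2n t x hx).deriv.symm)
      (hRt t x hx) (hRx t x hx)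
  -- the identity on `[X, Y]`
  have hint : ∀ Y, X ≤ Y → ∫ x in X..Y, en x = (∫ x in X..Y, e x) - b Y + b X := by
    intro Y hY
    have hsub : ∀ x ∈ uIcc X Y, a < x := fun x hx => by
      rw [uIcc_of_le hY] at hx; exact haX'.trans_le hx.1
    have hci : IntervalIntegrable (fun x => e x - en x) volume X Y :=
      ((hec.sub henc).mono fun x hx => hsub x (by rw [uIcc_of_le hY]; exact hx)).intervalIntegrable_of_Icc hY
    have hftc := integral_eq_sub_of_hasDerivAt (fun x hx => hbd x (hsub x hx)) hci
    have hei : IntervalIntegrable e volume X Y :=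
      (hec.mono fun x hx => hsub x (by rw [uIcc_of_le hY]; exact hx)).intervalIntegrable_of_Icc hY
    have heni : IntervalIntegrable en volume X Y :=
      (henc.mono fun x hx => hsub x (by rw [uIcc_of_le hY]; exact hx)).intervalIntegrable_of_Icc hY
    rw [intervalIntegral.integral_sub hei heni] at hftc
    linarith
  -- the boundary term tends to zero
  have hbY : Tendsto b atTop (𝓝 0) := by
    have hsq1 : Tendsto (fun Y => θ t Y ^ 2 / Y) atTop (𝓝 0) :=
      tendsto_sq_div_self (f' := fun y => deriv (θ t) y) (X := X)
        (fun y hy => (h2 t y (haX'.trans_le hy)).congr_deriv (h2 t y (haX'.trans_le hy)).deriv.symm)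
        (hdxc.mono fun y hy => haX'.trans_le hy) hθx2
    have hsq2 : Tendsto (fun Y => θn t Y ^ 2 / Y) atTop (𝓝 0) :=
      tendsto_sq_div_self (f' := fun y => deriv (θn t) y) (X := X)
        (fun y hy => (h2n t y (haX'.trans_le hy)).congr_deriv (h2n t y (haX'.trans_le hy)).deriv.symm)
        (hdxnc.mono fun y hy => haX'.trans_le hy) hθnx2
    have hsum : Tendsto (fun Y => B * (θ t Y ^ 2 / Y + θn t Y ^ 2 / Y)) atTop (𝓝 0) := by
      simpa using (hsq1.add hsq2).const_mul B
    refine squeeze_zero_norm' ?_ hsum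
    filter_upwards [Filter.eventually_ge_atTop X] with Y hY
    have hY1 : X₁ ≤ Y := hX.trans hY
    have hY0 : 0 < Y := hX₁0.trans_le hY1
    have hWY := hWB Y hY1
    rw [Real.norm_eq_abs]
    have e1 : b Y = (Y * W Y) * (θ t Y ^ 2 / Y + θn t Y ^ 2 / Y) := by
      simp only [hb_def]; field_simp
    rw [e1, abs_mul]
    exact mul_le_mul_of_nonneg_right hWY (abs_nonneg _) |>.trans (le_of_eq (by
      rw [abs_of_nonneg (by positivity)]))
  -- pass to the limit
  have hlim_e := intervalIntegral_tendsto_integral_Ioi X he tendsto_id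
  have hlim_en := intervalIntegral_tendsto_integral_Ioi X hen tendsto_id
  have hlim2 : Tendsto (fun Y => (∫ x in X..id Y, e x) - b Y + b X) atTop
      (𝓝 ((∫ x in Ioi X, e x) - 0 + b X)) := (hlim_e.sub hbY).add_const (b X)
  have heq : ∫ x in Ioi X, en x = (∫ x in Ioi X, e x) - 0 + b X := by
    refine tendsto_nhds_unique hlim_en (hlim2.congr' ?_)
    filter_upwards [Filter.eventually_ge_atTop X] with Y hY
    exact (hint Y hY).symm
  have hbX : b X ≤ 0 := by
    have hW : W X ≤ 0 := by
      have h := hrec X hX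
      by_contra hpos
      have : 0 < X * W X := mul_pos (hX₁0.trans_le hX) (lt_of_not_ge hpos)
      linarith
    exact mul_nonpos_of_nonpos_of_nonneg hW (by positivity)
  have : ∫ x in Ioi X, en x ≤ ∫ x in Ioi X, e x := by rw [heq]; linarith
  exact this

/-- **The chain of peeled solutions.**  See the module docstring. -/
theorem exists_chain {a X₁ B C : ℝ} {ℓ : ℕ} {W U : ℕ → ℝ → ℝ} {ψ : ℝ → ℝ → ℝ}
    (haX : a < X₁) (hX1 : 1 ≤ X₁)
    (hUC : ∀ k, k ≤ ℓ → ContDiffOn ℝ ∞ (U k) (Ioi a))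
    (hWC : ∀ k, k < ℓ → ContDiffOn ℝ ∞ (W k) (Ioi a))
    (hWd : ∀ k, k < ℓ → ∀ x, a < x → HasDerivAt (W k) (U k x - W k x ^ 2) x)
    (hUs : ∀ k, k < ℓ → ∀ x, a < x → U (k + 1) x = 2 * W k x ^ 2 - U k x)
    (hrec : ∀ k, k < ℓ → ∀ x, X₁ ≤ x → x * W k x ≤ -3 / 4 ∧ |x * W k x| ≤ B)
    (hUB : ∀ k, k ≤ ℓ → ∀ x, X₁ ≤ x → |x ^ 2 * U k x| ≤ C)
    (hU0 : ∀ k, k ≤ ℓ → ∀ x, X₁ ≤ x → 0 ≤ U k x)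
    (hψC : ContDiffOn ℝ 2 (Function.uncurry ψ) {z : ℝ × ℝ | a < z.2})
    (hψsol : ∀ t x, a < x →
      iteratedDeriv 2 (fun τ => ψ τ x) t - iteratedDeriv 2 (ψ t) x + U 0 x * ψ t x = 0)
    (hψ1 : ∀ X, a < X → IntegrableOn (fun x => deriv (fun τ => ψ τ x) 0 ^ 2) (Ioi X))
    (hψ2 : ∀ X, a < X → IntegrableOn (fun x => deriv (ψ 0) x ^ 2) (Ioi X))
    (hψ3 : ∀ X, a < X → 1 ≤ X → IntegrableOn (fun x => (ψ 0 x / x) ^ 2) (Ioi X))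
    (n : ℕ) (hn : n ≤ ℓ) :
    ∃ θ : ℕ → ℝ → ℝ → ℝ, θ 0 = ψ ∧
      (∀ k, k ≤ n →
        ContDiffOn ℝ 2 (Function.uncurry (θ k)) {z : ℝ × ℝ | a < z.2} ∧
        (∀ t x, a < x → iteratedDeriv 2 (fun τ => θ k τ x) t - iteratedDeriv 2 (θ k t) x
          + U k x * θ k t x = 0) ∧
        (∀ X, a < X → IntegrableOn (fun x => deriv (fun τ => θ k τ x) 0 ^ 2) (Ioi X)) ∧
        (∀ X, a < X → IntegrableOn (fun x => deriv (θ k 0) x ^ 2) (Ioi X)) ∧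
        (∀ X, a < X → 1 ≤ X → IntegrableOn (fun x => (θ k 0 x / x) ^ 2) (Ioi X))) ∧
      (∀ k, k < n →
        (∀ x, a < x → deriv (fun τ => θ (k + 1) τ x) 0 = deriv (θ k 0) x - W k x * θ k 0 x) ∧
        (∀ x, a < x → deriv (θ (k + 1) 0) x = deriv (fun τ => θ k τ x) 0 - W k x * θ (k + 1) 0 x)) ∧
      (∀ k, k ≤ n → ∀ t X, X₁ ≤ X →
        IntegrableOn (fun x => deriv (fun τ => θ k τ x) t ^ 2 + deriv (θ k t) x ^ 2
          + U k x * θ k t x ^ 2) (Ioi X) ∧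
        ∫ x in Ioi X, (deriv (fun τ => θ k τ x) t ^ 2 + deriv (θ k t) x ^ 2 + U k x * θ k t x ^ 2)
          ≤ ∫ x in Ioi X, (deriv (fun τ => θ 0 τ x) t ^ 2 + deriv (θ 0 t) x ^ 2
            + U 0 x * θ 0 t x ^ 2)) := by
  induction n with
  | zero =>
    refine ⟨fun _ => ψ, rfl, fun k hk => ?_, fun k hk => absurd hk (Nat.not_lt_zero _), fun k hk t X hX => ?_⟩
    · obtain rfl : k = 0 := Nat.le_zero.1 hk
      exact ⟨hψC, hψsol, hψ1, hψ2, hψ3⟩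
    · obtain rfl : k = 0 := Nat.le_zero.1 hk
      obtain ⟨-, -, -, he⟩ := level_integrable haX hX1 (hUC 0 (Nat.zero_le _)).continuousOn
        (hU0 0 (Nat.zero_le _)) (hUB 0 (Nat.zero_le _)) hψC hψsol hψ1 hψ2 hψ3 t (haX.trans_le hX)
      exact ⟨he, le_rfl⟩
  | succ n ih =>
    have hn' : n < ℓ := Nat.lt_of_succ_le hn
    obtain ⟨θ, hθ0, hlev, hrel, hen⟩ := ih hn'.le
    obtain ⟨hCn, hsoln, hI1n, hI2n, hI3n⟩ := hlev n le_rfl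
    -- the rung `n → n+1`
    have hX0 : 0 < X₁ := by linarith
    obtain ⟨θn, w, hw0, hwd, -, hCt, hsolt, hRt, hRx, hwi, htail⟩ :=
      exists_rung (U := U n) (Ut := U (n + 1)) (hWC n hn') (hWd n hn') (hUs n hn')
        ⟨X₁, haX, hX0, fun x hx => (hrec n hn' x hx).1⟩ hCn hsoln hI1n
    obtain ⟨hJ1, hJ2, hJ3⟩ := rung_initial_integrable (B := B) haX hX1 (fun x hx => (hrec n hn' x hx).1)
      (fun x hx => (hrec n hn' x hx).2) hw0 hwd hCn hCt (fun x hx => hRt 0 x hx) (fun x hx => hRx 0 x hx)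
      hwi htail hI1n hI2n hI3n
    have henergy : ∀ t X, X₁ ≤ X →
        IntegrableOn (fun x => deriv (fun τ => θn τ x) t ^ 2 + deriv (θn t) x ^ 2
          + U (n + 1) x * θn t x ^ 2) (Ioi X) ∧
        ∫ x in Ioi X, (deriv (fun τ => θn τ x) t ^ 2 + deriv (θn t) x ^ 2 + U (n + 1) x * θn t x ^ 2)
          ≤ ∫ x in Ioi X, (deriv (fun τ => θ n τ x) t ^ 2 + deriv (θ n t) x ^ 2 + U n x * θ n t x ^ 2) := by
      intro t X hX
      obtain ⟨-, h2, h3⟩ := rung_energy_le haX hX1 (hUC n hn'.le).continuousOn (hUC (n + 1) hn).continuousOn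
        (hWd n hn') (hUs n hn') (fun x hx => (hrec n hn' x hx).1) (fun x hx => (hrec n hn' x hx).2)
        (hUB n hn'.le) (hU0 n hn'.le) (hU0 (n + 1) hn) hCn hsoln hCt hsolt hRt hRx hI1n hI2n hI3n
        hJ1 hJ2 hJ3 t hX
      exact ⟨h2, h3⟩
    -- the updated family
    set θ' : ℕ → ℝ → ℝ → ℝ := Function.update θ (n + 1) θn with hθ'
    have hold : ∀ k, k ≤ n → θ' k = θ k := fun k hk =>
      Function.update_of_ne (by omega) _ _
    have hnew : θ' (n + 1) = θn := Function.update_self _ _ _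
    have h0' : θ' 0 = ψ := by rw [hold 0 (Nat.zero_le _), hθ0]
    refine ⟨θ', h0', fun k hk => ?_, fun k hk => ?_, fun k hk t X hX => ?_⟩
    · rcases Nat.lt_or_eq_of_le hk with h | h
      · rw [hold k (Nat.lt_succ_iff.1 h)]; exact hlev k (Nat.lt_succ_iff.1 h)
      · rw [h, hnew]; exact ⟨hCt, hsolt, hJ1, hJ2, hJ3⟩
    · rcases Nat.lt_or_eq_of_le (Nat.lt_succ_iff.1 hk) with h | h
      · rw [hold k h.le, hold (k + 1) h]; exact hrel k h
      · rw [h, hold n le_rfl, hnew]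
        exact ⟨fun x hx => hRt 0 x hx, fun x hx => hRx 0 x hx⟩
    · rw [hold 0 (Nat.zero_le _)]
      rcases Nat.lt_or_eq_of_le hk with h | h
      · rw [hold k (Nat.lt_succ_iff.1 h)]; exact hen k (Nat.lt_succ_iff.1 h) t X hX
      · rw [h, hnew]
        obtain ⟨h1, h2⟩ := henergy t X hX
        exact ⟨h1, h2.trans (hen n le_rfl t X hX).2⟩

/-- Registered sub-goal `peel_rungEnergyLe` of `stub_peel` (verbatim signature): a Darboux rung never increases far energies. -/
theorem peel_rungEnergyLe : ∀ (a X₁ B C : ℝ) (U Ut W : ℝ → ℝ) (θ θn : ℝ → ℝ → ℝ), a < X₁ → 1 ≤ X₁ → ContinuousOn U (Set.Ioi a) → ContinuousOn Ut (Set.Ioi a) → (∀ x, a < x → HasDerivAt W (U x - W x ^ 2) x) → (∀ x, a < x → Ut x = 2 * W x ^ 2 - U x) → (∀ x, X₁ ≤ x → x * W x ≤ -3 / 4) → (∀ x, X₁ ≤ x → |x * W x| ≤ B) → (∀ x, X₁ ≤ x → |x ^ 2 * U x| ≤ C) → (∀ x, X₁ ≤ x → 0 ≤ U x) → (∀ x,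 X₁ ≤ x → 0 ≤ Ut x) → ContDiffOn ℝ 2 (Function.uncurry θ) {z : ℝ × ℝ | a < z.2} → (∀ t x, a < x → iteratedDeriv 2 (fun τ => θ τ x) t - iteratedDeriv 2 (θ t) x + U x * θ t x = 0) → ContDiffOn ℝ 2 (Function.uncurry θn) {z : ℝ × ℝ | a < z.2} → (∀ t x, a < x → iteratedDeriv 2 (fun τ => θn τ x) t - iteratedDeriv 2 (θn t) x + Ut x * θn t x = 0) → (∀ t x, a < x → deriv (fun τ => θn τ x) t = deriv (θ t) x - W x * θ t x) → (∀ t x, a < x → deriv (θn t) x = deriv (fun τ => θ τ x) t - W x * θn t x) → (∀ X, a < X → MeasureTheory.IntegrableOn (fun x => deriv (fun τ => θ τ x) 0 ^ 2) (Set.Ioi X)) → (∀ X, a < X → MeasureTheory.IntegrableOn (fun x => deriv (θ 0) x ^ 2) (Set.Ioi X)) → (∀ X, a < X → 1 ≤ X → MeasureTheory.IntegrableOn (fun x => (θ 0 x / x) ^ 2) (Set.Ioi X)) → (∀ X, a < X → MeasureTheory.IntegrableOn (fun x => deriv (fun τ => θn τ x) 0 ^ 2) (Set.Ioi X)) → (∀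 X, a < X → MeasureTheory.IntegrableOn (fun x => deriv (θn 0) x ^ 2) (Set.Ioi X)) → (∀ X, a < X → 1 ≤ X → MeasureTheory.IntegrableOn (fun x => (θn 0 x / x) ^ 2) (Set.Ioi X)) → ∀ (t X : ℝ), X₁ ≤ X → MeasureTheory.integral (MeasureTheory.volume.restrict (Set.Ioi X)) (fun x => deriv (fun τ => θn τ x) t ^ 2 + deriv (θn t) x ^ 2 + Ut x * θn t x ^ 2) ≤ MeasureTheory.integral (MeasureTheory.volume.restrict (Set.Ioi X)) (fun x => deriv (fun τ => θ τ x) t ^ 2 + deriv (θ t) x ^ 2 + U x * θ t x ^ 2) :=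
  fun _ _ _ _ _ _ _ _ _ haX hX1 hUc hUtc hWd hUt hrec hWB hUB hU0 hUt0 hθ hsol hθn hsoln hRt hRx hI1 hI2 hI3 hJ1 hJ2 hJ3 t _ hX => (rung_energy_le haX hX1 hUc hUtc hWd hUt hrec hWB hUB hU0 hUt0 hθ hsol hθn hsoln hRt hRx hI1 hI2 hI3 hJ1 hJ2 hJ3 t hX).2.2

end Summit.FinalStateConjecture.FinalStateConjecture.Theorems.CrumPeelingRecessiveTower
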